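import Summits.QuantumAdvantage.QuantumAdvantage.Theorems.CubicForrelationSignedExactCubicForrelationNotPrBPPStubNoTrapTemplate
import Summits.QuantumAdvantage.QuantumAdvantage.Theorems.CubicForrelationSignedExactCubicForrelationNotPrBPPStubNoTrapTransport

/-!
# Crux `CubicForrelation.SignedExactCubicForrelationNotPrBPP` (stmt-QuantumAdvantage-13932), line `dual-pingpong-frame`
# (GROW reshape c3): stub `stub_kernelStatsRadical` — kernel statistics at radical-visible pairs

Support file (`--supports stmt-QuantumAdvantage-13932`). The registered stub `stub_kernelStatsRadical` is the
ASSEMBLY of the radical-visible case of the kernel statistics of the GROW finder (`Grow.KernelStats`, `b`-side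
disjunct), with `r = n + 1` probes (`n = m + m`), from its three bricks, which enter as the first three
hypotheses (they are the statements of the neighbouring stubs `stub_spanHalf`, `stub_spanningOfNoDual`,
`stub_radicalGood`):

* the probe clause "`v' ∈ rad B_x`" (`D_x D_{v'} b` constant) holds at `x = 0` and is `⊕`-closed in the probe
  slot `x` (cocycle law of second differences, valid for EVERY Boolean function), so for a tuple of probes
  without a common non-zero annihilator (a spanning tuple, second brick) a candidate satisfies the clause at
  every `x`, i.e. is a radical direction (`radical_of_probes`);
* every candidate outside `S` is then GOOD by the third brick, applied with the no-trap extension `V ⊋ S` of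
  the pair (landed `stub_noTrapTransport stub_noTrapTemplate`, `|V| = 2^m > |S|`);
* the candidate space `K` is closed under `u ↦ u ⊕ v` for the radical witness `v ∈ K ∖ S`, which injects
  `K ∩ S` into `K ∖ S`, so the good density is `≥ 1/2` (`half_le_card_filter_div_card`);
* non-spanning tuples are at most half of all `2^{n(n+1)}` tuples (first brick) and contribute `≥ 0`, so the
  sum of densities is `≥ 2^{n(n+1)}/4 ≥ 2^{n(n+1)}/(n+2)^8` (`quarter_card_le_sum`).

No definitions. Second differences are spelled out, `D_u D_w b (x) = b x ⊕ b (x ⊕ u) ⊕ b (x ⊕ w) ⊕ b (x ⊕ u ⊕ w)`,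
exactly as in the registered statement.

References: C. Carlet, *Boolean Functions for Cryptography and Coding Theory*, CUP 2021, §2.2.2 (derivatives),
Prop. 54 (M-subspaces of the completed Maiorana–McFarland class) [Carlet2020]; S. Arora, B. Barak,
*Computational Complexity: A Modern Approach*, CUP 2009, §7.1 (success probabilities by counting) [AroraBarak2009]. -/

noncomputable section

set_option linter.dupNamespace false -- D-0017: single-problem summit ⇒ `QuantumAdvantage.QuantumAdvantage` by design

namespace Summit.QuantumAdvantage.QuantumAdvantage.Theorems.SignedExactCubicForrelationNotPrBPP

open Finset
open Literature.Computability.Complexity Literature.Computability.QuantumComplexity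
open Literature.Computability.QuantumComplexity.BuzetChailloux (bxor zeroVec bxor_self bxor_comm bxor_zeroVec
  zeroVec_bxor bxor_bxor_cancel_left)

namespace KernelStatsRadical

variable {n : ℕ}

/-! ### Second differences: additivity in either slot (no hypothesis on `b`) -/

/-- Additivity of `D_s D_w b (x)` in the slot `w`, pointwise:
`D_s D_{u ⊕ v} b (x) = D_s D_u b (x) ⊕ D_s D_v b (x ⊕ u)`. [cite: Carlet2020, §2.2.2] -/
theorem d2_bxor_right (b : (Fin n → Bool) → Bool) (s u v x : Fin n → Bool) :
    (b x ^^ b (bxor x s) ^^ b (bxor x (bxor u v)) ^^ b (bxor x (bxor s (bxor u v)))) =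
      ((b x ^^ b (bxor x s) ^^ b (bxor x u) ^^ b (bxor x (bxor s u))) ^^
        (b (bxor x u) ^^ b (bxor (bxor x u) s) ^^ b (bxor (bxor x u) v) ^^ b (bxor (bxor x u) (bxor s v)))) := by
  have e1 : b (bxor (bxor x u) s) = b (bxor x (bxor s u)) :=
    congrArg b (by show (x + u) + s = x + (s + u); abel)
  have e2 : b (bxor (bxor x u) v) = b (bxor x (bxor u v)) :=
    congrArg b (by show (x + u) + v = x + (u + v); abel)
  have e3 : b (bxor (bxor x u) (bxor s v)) = b (bxor x (bxor s (bxor u v))) :=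
    congrArg b (by show (x + u) + (s + v) = x + (s + (u + v)); abel)
  rw [e1, e2, e3]
  generalize b x = A; generalize b (bxor x s) = B; generalize b (bxor x u) = C
  generalize b (bxor x (bxor s u)) = E; generalize b (bxor x (bxor u v)) = F
  generalize b (bxor x (bxor s (bxor u v))) = G
  revert A B C E F G; decide

/-- Additivity of `D_x D_v b (z)` in the slot `x` (cocycle law), pointwise:
`D_{x ⊕ x'} D_v b (z) = D_x D_v b (z) ⊕ D_{x'} D_v b (z ⊕ x)`. [cite: Carlet2020, §2.2.2] -/
theorem d2_bxor_left (b : (Fin n → Bool) → Bool) (x x' v z : Fin n → Bool) :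
    (b z ^^ b (bxor z (bxor x x')) ^^ b (bxor z v) ^^ b (bxor z (bxor (bxor x x') v))) =
      ((b z ^^ b (bxor z x) ^^ b (bxor z v) ^^ b (bxor z (bxor x v))) ^^
        (b (bxor z x) ^^ b (bxor (bxor z x) x') ^^ b (bxor (bxor z x) v) ^^ b (bxor (bxor z x) (bxor x' v)))) := by
  have e1 : b (bxor (bxor z x) x') = b (bxor z (bxor x x')) :=
    congrArg b (by show (z + x) + x' = z + (x + x'); abel)
  have e2 : b (bxor (bxor z x) v) = b (bxor z (bxor x v)) :=
    congrArg b (by show (z + x) + v = z + (x + v); abel)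
  have e3 : b (bxor (bxor z x) (bxor x' v)) = b (bxor z (bxor (bxor x x') v)) :=
    congrArg b (by show (z + x) + (x' + v) = z + ((x + x') + v); abel)
  rw [e1, e2, e3]
  generalize b z = A; generalize b (bxor z x) = B; generalize b (bxor z v) = C
  generalize b (bxor z (bxor x v)) = E; generalize b (bxor z (bxor x x')) = F
  generalize b (bxor z (bxor (bxor x x') v)) = G
  revert A B C E F G; decide

/-! ### The three clauses of the candidate space are `⊕`-closed in the candidate slot -/

/-- `Z_b(S) = {w : D_s D_w b ≡ 0 ∀ s ∈ S}` is closed under `⊕`. [cite: Carlet2020, §2.2.2] -/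
theorem zs_bxor (b : (Fin n → Bool) → Bool) (S : Finset (Fin n → Bool)) (u v : Fin n → Bool)
    (hu : ∀ s ∈ S, ∀ x, (b x ^^ b (bxor x s) ^^ b (bxor x u) ^^ b (bxor x (bxor s u))) = false)
    (hv : ∀ s ∈ S, ∀ x, (b x ^^ b (bxor x s) ^^ b (bxor x v) ^^ b (bxor x (bxor s v))) = false) :
    ∀ s ∈ S, ∀ x, (b x ^^ b (bxor x s) ^^ b (bxor x (bxor u v)) ^^ b (bxor x (bxor s (bxor u v)))) = false := by
  intro s hs x
  have h := d2_bxor_right b s u v x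
  rw [hu s hs x, hv s hs (bxor x u)] at h
  exact h.trans (by decide)

/-- `U^⊥` is closed under `⊕` (bilinearity of the inner product). [folklore] -/
theorem pu_bxor (U : Finset (Fin n → Bool)) (u v : Fin n → Bool)
    (hu : ∀ w ∈ U, ((Finset.univ.filter fun i => w i && u i).card).bodd = false)
    (hv : ∀ w ∈ U, ((Finset.univ.filter fun i => w i && v i).card).bodd = false) :
    ∀ w ∈ U, ((Finset.univ.filter fun i => w i && bxor u v i).card).bodd = false := by
  intro w hw
  have h := PolarGeometry.bdot_bxor_right w u v
  rw [hu w hw, hv w hw] at h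
  exact h.trans (by decide)

/-- The radical clause at the probe `x` ("`D_x D_w b` is constant") is closed under `⊕` in the candidate slot `w`.
[cite: Carlet2020, §2.2.2] -/
theorem rc_bxor_right (b : (Fin n → Bool) → Bool) (x u v : Fin n → Bool)
    (hu : ∀ y z : Fin n → Bool, ((b z ^^ b (bxor z x) ^^ b (bxor z u) ^^ b (bxor z (bxor x u))) ^^
      (b (bxor z y) ^^ b (bxor (bxor z y) x) ^^ b (bxor (bxor z y) u) ^^ b (bxor (bxor z y) (bxor x u)))) = false)
    (hv : ∀ y z : Fin n → Bool, ((b z ^^ b (bxor z x) ^^ b (bxor z v) ^^ b (bxor z (bxor x v))) ^^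
      (b (bxor z y) ^^ b (bxor (bxor z y) x) ^^ b (bxor (bxor z y) v) ^^ b (bxor (bxor z y) (bxor x v)))) = false) :
    ∀ y z : Fin n → Bool, ((b z ^^ b (bxor z x) ^^ b (bxor z (bxor u v)) ^^ b (bxor z (bxor x (bxor u v)))) ^^
      (b (bxor z y) ^^ b (bxor (bxor z y) x) ^^ b (bxor (bxor z y) (bxor u v)) ^^
        b (bxor (bxor z y) (bxor x (bxor u v))))) = false := by
  intro y z
  have h1 := hu y z
  have h2 := hv y (bxor z u)
  have e : bxor (bxor z y) u = bxor (bxor z u) y := by show (z + y) + u = (z + u) + y; abel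
  rw [← e] at h2
  rw [d2_bxor_right b x u v z, d2_bxor_right b x u v (bxor z y)]
  have key : ∀ a c e g : Bool, (a ^^ e) = false → (c ^^ g) = false → ((a ^^ c) ^^ (e ^^ g)) = false := by
    decide
  exact key _ _ _ _ h1 h2

/-- The radical clause for the candidate `v` is closed under `⊕` in the PROBE slot: if `D_x D_v b` and
`D_{x'} D_v b` are constant then so is `D_{x ⊕ x'} D_v b`. [cite: Carlet2020, §2.2.2] -/
theorem rc_bxor_left (b : (Fin n → Bool) → Bool) (x x' v : Fin n → Bool)
    (hx : ∀ y z : Fin n → Bool, ((b z ^^ b (bxor z x) ^^ b (bxor z v) ^^ b (bxor z (bxor x v))) ^^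
      (b (bxor z y) ^^ b (bxor (bxor z y) x) ^^ b (bxor (bxor z y) v) ^^ b (bxor (bxor z y) (bxor x v)))) = false)
    (hx' : ∀ y z : Fin n → Bool, ((b z ^^ b (bxor z x') ^^ b (bxor z v) ^^ b (bxor z (bxor x' v))) ^^
      (b (bxor z y) ^^ b (bxor (bxor z y) x') ^^ b (bxor (bxor z y) v) ^^ b (bxor (bxor z y) (bxor x' v)))) = false) :
    ∀ y z : Fin n → Bool, ((b z ^^ b (bxor z (bxor x x')) ^^ b (bxor z v) ^^ b (bxor z (bxor (bxor x x') v))) ^^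
      (b (bxor z y) ^^ b (bxor (bxor z y) (bxor x x')) ^^ b (bxor (bxor z y) v) ^^
        b (bxor (bxor z y) (bxor (bxor x x') v)))) = false := by
  intro y z
  have h1 := hx y z
  have h2 := hx' y (bxor z x)
  have e : bxor (bxor z y) x = bxor (bxor z x) y := by show (z + y) + x = (z + x) + y; abel
  rw [← e] at h2
  rw [d2_bxor_left b x x' v z, d2_bxor_left b x x' v (bxor z y)]
  have key : ∀ a c e g : Bool, (a ^^ e) = false → (c ^^ g) = false → ((a ^^ c) ^^ (e ^^ g)) = false := by
    decide
  exact key _ _ _ _ h1 h2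

/-- The radical clause holds at the probe `x = 0` (`D_0 ≡ 0`). [folklore] -/
theorem rc_zero (b : (Fin n → Bool) → Bool) (v : Fin n → Bool) :
    ∀ y z : Fin n → Bool, ((b z ^^ b (bxor z zeroVec) ^^ b (bxor z v) ^^ b (bxor z (bxor zeroVec v))) ^^
      (b (bxor z y) ^^ b (bxor (bxor z y) zeroVec) ^^ b (bxor (bxor z y) v) ^^
        b (bxor (bxor z y) (bxor zeroVec v)))) = false := by
  intro y z
  simp only [bxor_zeroVec, zeroVec_bxor]
  generalize b z = A; generalize b (bxor z v) = B; generalize b (bxor z y) = C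
  generalize b (bxor (bxor z y) v) = E
  revert A B C E; decide

/-! ### Spanning probes see the radical; counting -/

/-- **Spanning probes test the whole radical clause.** If every `⊕`-closed set containing `0` and all probes
`xs j` is the whole space, then a candidate `v` satisfying the radical clause at every probe satisfies it at
every `x` (the clause is `⊕`-closed in the probe and holds at `0`). [cite: Carlet2020, §2.2.2] -/
theorem radical_of_probes {r : ℕ} (b : (Fin n → Bool) → Bool) (xs : Fin r → (Fin n → Bool)) (v : Fin n → Bool)
    (hspan : ∀ W : Finset (Fin n → Bool), zeroVec ∈ W → (∀ x ∈ W, ∀ y ∈ W, bxor x y ∈ W) → (∀ j, xs j ∈ W) →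
      W = Finset.univ)
    (hj : ∀ j, ∀ y z : Fin n → Bool, ((b z ^^ b (bxor z (xs j)) ^^ b (bxor z v) ^^ b (bxor z (bxor (xs j) v))) ^^
      (b (bxor z y) ^^ b (bxor (bxor z y) (xs j)) ^^ b (bxor (bxor z y) v) ^^ b (bxor (bxor z y) (bxor (xs j) v)))) =
        false) :
    ∀ x y z : Fin n → Bool, ((b z ^^ b (bxor z x) ^^ b (bxor z v) ^^ b (bxor z (bxor x v))) ^^
      (b (bxor z y) ^^ b (bxor (bxor z y) x) ^^ b (bxor (bxor z y) v) ^^ b (bxor (bxor z y) (bxor x v)))) = false := by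
  have hWu := hspan
    (Finset.univ.filter fun x : Fin n → Bool => ∀ y z : Fin n → Bool,
      ((b z ^^ b (bxor z x) ^^ b (bxor z v) ^^ b (bxor z (bxor x v))) ^^
        (b (bxor z y) ^^ b (bxor (bxor z y) x) ^^ b (bxor (bxor z y) v) ^^ b (bxor (bxor z y) (bxor x v)))) = false)
    (Finset.mem_filter.2 ⟨Finset.mem_univ _, rc_zero b v⟩)
    (fun x hx x' hx' => Finset.mem_filter.2
      ⟨Finset.mem_univ _, rc_bxor_left b x x' v (Finset.mem_filter.1 hx).2 (Finset.mem_filter.1 hx').2⟩)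
    (fun j => Finset.mem_filter.2 ⟨Finset.mem_univ _, hj j⟩)
  intro x
  have hx := Finset.mem_univ x
  rw [← hWu] at hx
  exact (Finset.mem_filter.1 hx).2

/-- **Good density `≥ 1/2`.** If `v ∈ K ∖ S`, `K` is stable under `· ⊕ v`, `S` is `⊕`-closed and every element
of `K ∖ S` is good, then at least half of `K` is good: `u ↦ u ⊕ v` injects `K ∩ S` into `K ∖ S`.
[cite: AroraBarak2009, §7.1] -/
theorem half_le_card_filter_div_card (good : (Fin n → Bool) → Prop) (inst : DecidablePred good)
    (K S : Finset (Fin n → Bool)) (v : Fin n → Bool) (hvK : v ∈ K) (hvS : v ∉ S)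
    (hS : ∀ x ∈ S, ∀ y ∈ S, bxor x y ∈ S) (hK : ∀ u ∈ K, bxor u v ∈ K)
    (hgood : ∀ u ∈ K, u ∉ S → good u) :
    1 / 2 ≤ ((@Finset.filter _ good inst K).card : ℝ) / (K.card : ℝ) := by
  have hKpos : (0 : ℝ) < K.card := by exact_mod_cast Finset.card_pos.2 ⟨v, hvK⟩
  have hinj : (K.filter (· ∈ S)).card ≤ (K.filter (· ∉ S)).card := by
    refine Finset.card_le_card_of_injOn (fun u => bxor u v) ?_ ?_
    · intro u hu
      have hu' := Finset.mem_filter.1 (Finset.mem_coe.1 hu)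
      refine Finset.mem_coe.2 (Finset.mem_filter.2 ⟨hK u hu'.1, fun h => hvS ?_⟩)
      have h' := hS u hu'.2 (bxor u v) h
      rwa [bxor_bxor_cancel_left] at h'
    · intro u _ u' _ h
      have h' : bxor u v = bxor u' v := h
      calc u = bxor v (bxor v u) := (bxor_bxor_cancel_left v u).symm
        _ = bxor v (bxor v u') := by rw [bxor_comm v u, h', bxor_comm u' v]
        _ = u' := bxor_bxor_cancel_left v u'
  have hsum : (K.filter (· ∈ S)).card + (K.filter (· ∉ S)).card = K.card :=
    Finset.card_filter_add_card_filter_not _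
  have hsub : (K.filter (· ∉ S)).card ≤ (@Finset.filter _ good inst K).card := by
    refine Finset.card_le_card fun u hu => ?_
    have hu' := Finset.mem_filter.1 hu
    exact (@Finset.mem_filter _ good inst K u).2 ⟨hu'.1, hgood u hu'.1 hu'.2⟩
  have h2 : K.card ≤ 2 * (@Finset.filter _ good inst K).card := by omega
  have h2' : (K.card : ℝ) ≤ 2 * ((@Finset.filter _ good inst K).card : ℝ) := by exact_mod_cast h2
  rw [le_div_iff₀ hKpos]
  linarith

/-- **Averaging.** If `f ≥ 0` everywhere, `f ≥ 1/2` off `P`, and `P` holds on at most half of a finite type,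
then `∑ f ≥ |α| / 4`. [cite: AroraBarak2009, §7.1] -/
theorem quarter_card_le_sum {α : Type*} [Fintype α] {P : α → Prop} {hdec : DecidablePred P} {f : α → ℝ}
    (h0 : ∀ x, 0 ≤ f x) (h1 : ∀ x, ¬ P x → 1 / 2 ≤ f x)
    (hP : 2 * (Finset.univ.filter P).card ≤ Fintype.card α) :
    (Fintype.card α : ℝ) / 4 ≤ ∑ x, f x := by
  have hsplit := Finset.sum_filter_add_sum_filter_not (Finset.univ : Finset α) P f
  have hA : (0 : ℝ) ≤ ∑ x ∈ Finset.univ.filter P, f x := Finset.sum_nonneg fun x _ => h0 x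
  have hB : ∑ _x ∈ Finset.univ.filter (fun x => ¬ P x), (1 / 2 : ℝ) ≤
      ∑ x ∈ Finset.univ.filter (fun x => ¬ P x), f x :=
    Finset.sum_le_sum fun x hx => h1 x (Finset.mem_filter.1 hx).2
  rw [Finset.sum_const, nsmul_eq_mul] at hB
  have hC : ((Finset.univ.filter P).card : ℝ) + ((Finset.univ.filter fun x => ¬ P x).card : ℝ) =
      Fintype.card α := by
    exact_mod_cast Finset.card_filter_add_card_filter_not (s := (Finset.univ : Finset α)) P
  have hP' : (2 : ℝ) * (Finset.univ.filter P).card ≤ Fintype.card α := by exact_mod_cast hP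
  rw [← hsplit]
  linarith

end KernelStatsRadical

open KernelStatsRadical in
/-- **Kernel statistics at radical-visible pairs (`r = n + 1` probes).** Registered stub `stub_kernelStatsRadical`
of line `dual-pingpong-frame`: given the three bricks (spanning tuples are the majority; no common annihilator
⇒ spanning; radical directions are good), if some radical direction `v` of `b = C 1` lies in
`Z_b(S) ∩ U^⊥ ∖ S`, then the `b`-side disjunct of `Grow.KernelStats` holds with `r = m + m + 1`: for a spanning
tuple the candidate space consists of radical directions (`radical_of_probes`), each candidate outside `S` is
good (third brick with the no-trap extension `V ⊋ S`, landed `stub_noTrapTransport stub_noTrapTemplate`,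
`|V| = 2^m > |S|`), at least half of the candidates lie outside `S` (`half_le_card_filter_div_card`), and
spanning tuples are at least half of all `2^{n(n+1)}` tuples, whence the sum is `≥ 2^{n(n+1)}/4 ≥ 2^{n(n+1)}/(n+2)^8`.
[cite: Carlet2020, Prop. 54; AroraBarak2009, §7.1] -/
theorem stub_kernelStatsRadical :
    (∀ n : ℕ, 2 * (Finset.univ.filter fun xs : Fin (n + 1) → (Fin n → Bool) =>
        ∃ w : Fin n → Bool, w ≠ zeroVec ∧ ∀ j, ((Finset.univ.filter fun i => w i && xs j i).card).bodd = false).card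
      ≤ 2 ^ (n * (n + 1))) →
    (∀ (n r : ℕ) (xs : Fin r → (Fin n → Bool)),
      (∀ w : Fin n → Bool, (∀ j, ((Finset.univ.filter fun i => w i && xs j i).card).bodd = false) → w = zeroVec) →
      ∀ W : Finset (Fin n → Bool), zeroVec ∈ W → (∀ x ∈ W, ∀ y ∈ W, bxor x y ∈ W) → (∀ j, xs j ∈ W) → W = Finset.univ) →
    (∀ (n : ℕ) (b : (Fin n → Bool) → Bool) (S U V : Finset (Fin n → Bool)) (v : Fin n → Bool),
      (zeroVec ∈ S ∧ ∀ x ∈ S, ∀ y ∈ S, bxor x y ∈ S) →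
      ((zeroVec ∈ V ∧ ∀ x ∈ V, ∀ y ∈ V, bxor x y ∈ V) ∧ (((V).card : ℝ) ^ 2 = (2 : ℝ) ^ n) ∧
        ∀ u ∈ V, ∀ w ∈ V, ∀ x, (b x ^^ b (bxor x u) ^^ b (bxor x w) ^^ b (bxor x (bxor u w))) = false) →
      S ⊆ V → (∀ s ∈ V, ∀ u ∈ U, ((Finset.univ.filter fun i => s i && u i).card).bodd = false) → S.card < V.card →
      (∀ x y z : Fin n → Bool, ((b z ^^ b (bxor z x) ^^ b (bxor z v) ^^ b (bxor z (bxor x v))) ^^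
          (b (bxor z y) ^^ b (bxor (bxor z y) x) ^^ b (bxor (bxor z y) v) ^^ b (bxor (bxor z y) (bxor x v)))) = false) →
      (∀ s ∈ S, ∀ x, (b x ^^ b (bxor x s) ^^ b (bxor x v) ^^ b (bxor x (bxor s v))) = false) →
      (∀ u ∈ U, ((Finset.univ.filter fun i => u i && v i).card).bodd = false) →
      ∃ V' : Finset (Fin n → Bool), ((zeroVec ∈ V' ∧ ∀ x ∈ V', ∀ y ∈ V', bxor x y ∈ V') ∧ (((V').card : ℝ) ^ 2 = (2 : ℝ) ^ n) ∧
          ∀ u ∈ V', ∀ w ∈ V', ∀ x, (b x ^^ b (bxor x u) ^^ b (bxor x w) ^^ b (bxor x (bxor u w))) = false) ∧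
        S ⊆ V' ∧ v ∈ V' ∧ (∀ s ∈ V', ∀ u ∈ U, ((Finset.univ.filter fun i => s i && u i).card).bodd = false)) →
    ∀ (m : ℕ) (C : Fin 2 → Circuit (Fin (m + m))),
        (⟨m + m, 2, C⟩ : KForrelationInstance).IsOverB2 →
        (∀ i, IsDegLeFun 3 (C i).eval) →
        (forrelation (C 0).eval (C 1).eval = 1 ∨ forrelation (C 0).eval (C 1).eval = -1) →
        (∃ e : (Fin (m + m) → Bool) ≃ (Fin (m + m) → Bool),
          (∃ M : Matrix (Fin (m + m)) (Fin (m + m)) (ZMod 2), ∃ c : Fin (m + m) → ZMod 2,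
            ∀ y i, (if e y i then (1 : ZMod 2) else 0) = (M.mulVec (fun j => if y j then (1 : ZMod 2) else 0) + c) i) ∧
          ∃ perm : (Fin m → Bool) ≃ (Fin m → Bool), ∃ h : (Fin m → Bool) → Bool, ∀ y' y'' : Fin m → Bool,
            (if (C 1).eval (e (Fin.append y' y'')) then (1 : ZMod 2) else 0) =
              (∑ i, (if y' i then (1 : ZMod 2) else 0) * (if perm y'' i then (1 : ZMod 2) else 0)) +
                (if h y'' then (1 : ZMod 2) else 0)) →
        ∀ S U : Finset (Fin (m + m) → Bool),
          (zeroVec ∈ S ∧ ∀ x ∈ S, ∀ y ∈ S, bxor x y ∈ S) → (zeroVec ∈ U ∧ ∀ x ∈ U, ∀ y ∈ U, bxor x y ∈ U) →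
          ((∀ s ∈ S, ∀ y : Fin (m + m) → Bool, (fun k => ((C 1).eval zeroVec ^^ (C 1).eval (bxor zeroVec s) ^^ (C 1).eval (bxor zeroVec y) ^^ (C 1).eval (bxor zeroVec (bxor s y))) ^^ ((C 1).eval (fun j => decide (j = k)) ^^ (C 1).eval (bxor (fun j => decide (j = k)) s) ^^ (C 1).eval (bxor (fun j => decide (j = k)) y) ^^ (C 1).eval (bxor (fun j => decide (j = k)) (bxor s y)))) ∈ U) ∧ (∀ s ∈ S, ∃ ℓ ∈ U, ∀ r : Fin (m + m) → Bool, (∀ y z : Fin (m + m) → Bool, (((C 1).eval z ^^ (C 1).eval (bxor z s) ^^ (C 1).eval (bxor z r) ^^ (C 1).eval (bxor z (bxor s r))) ^^ ((C 1).eval (bxor z y) ^^ (C 1).eval (bxor (bxor z y) s) ^^ (C 1).eval (bxor (bxor z y) r) ^^ (C 1).eval (bxor (bxor z y) (bxor s r)))) = false) → ((C 1).eval r ^^ (C 1).eval (bxor r s) ^^ (C 1).eval zeroVec ^^ (C 1).eval s) = ((Finset.univ.filter fun i => ℓ i && r i).card).bodd)) →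
          ((∀ s ∈ U, ∀ y : Fin (m + m) → Bool, (fun k => ((C 0).eval zeroVec ^^ (C 0).eval (bxor zeroVec s) ^^ (C 0).eval (bxor zeroVec y) ^^ (C 0).eval (bxor zeroVec (bxor s y))) ^^ ((C 0).eval (fun j => decide (j = k)) ^^ (C 0).eval (bxor (fun j => decide (j = k)) s) ^^ (C 0).eval (bxor (fun j => decide (j = k)) y) ^^ (C 0).eval (bxor (fun j => decide (j = k)) (bxor s y)))) ∈ S) ∧ (∀ s ∈ U, ∃ ℓ ∈ S, ∀ r : Fin (m + m) → Bool, (∀ y z : Fin (m + m) → Bool, (((C 0).eval z ^^ (C 0).eval (bxor z s) ^^ (C 0).eval (bxor z r) ^^ (C 0).eval (bxor z (bxor s r))) ^^ ((C 0).eval (bxor z y) ^^ (C 0).eval (bxor (bxor z y) s) ^^ (C 0).eval (bxor (bxor z y) r) ^^ (C 0).eval (bxor (bxor z y) (bxor s r)))) = false) → ((C 0).eval r ^^ (C 0).eval (bxor r s) ^^ (C 0).eval zeroVec ^^ (C 0).eval s) = ((Finset.univ.filter fun i => ℓ i && r i).card).bodd)) →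
          (∀ s ∈ S, ∀ u ∈ U, ((Finset.univ.filter fun i => s i && u i).card).bodd = false) →
          S.card < 2 ^ m → U.card < 2 ^ m →
          (∃ v : Fin (m + m) → Bool, (∀ x y z : Fin (m + m) → Bool, (((C 1).eval z ^^ (C 1).eval (bxor z x) ^^ (C 1).eval (bxor z v) ^^ (C 1).eval (bxor z (bxor x v))) ^^ ((C 1).eval (bxor z y) ^^ (C 1).eval (bxor (bxor z y) x) ^^ (C 1).eval (bxor (bxor z y) v) ^^ (C 1).eval (bxor (bxor z y) (bxor x v)))) = false) ∧ (∀ s ∈ S, ∀ x, ((C 1).eval x ^^ (C 1).eval (bxor x s) ^^ (C 1).eval (bxor x v) ^^ (C 1).eval (bxor x (bxor s v))) = false) ∧ (∀ u ∈ U, ((Finset.univ.filter fun i => u i && v i).card).bodd = false) ∧ v ∉ S) →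
          (∃ r : ℕ, r ≤ m + m + 1 ∧ (2 : ℝ) ^ ((m + m) * r) / ((m + m + 2 : ℝ) ^ 8) ≤ (∑ xs : Fin (r) → (Fin (m + m) → Bool), (((@Finset.filter (Fin (m + m) → Bool) (fun v => v ∉ S ∧ (∃ V : Finset (Fin (m + m) → Bool), ((zeroVec ∈ V ∧ ∀ x ∈ V, ∀ y ∈ V, bxor x y ∈ V) ∧ (((V).card : ℝ) ^ 2 = (2 : ℝ) ^ (m + m)) ∧ ∀ u ∈ V, ∀ v ∈ V, ∀ x, ((C 1).eval x ^^ (C 1).eval (bxor x u) ^^ (C 1).eval (bxor x v) ^^ (C 1).eval (bxor x (bxor u v))) = false) ∧ S ⊆ V ∧ v ∈ V ∧ (∀ s ∈ V, ∀ u ∈ U, ((Finset.univ.filter fun i => s i && u i).card).bodd = false))) (Classical.decPred _) (Finset.univ.filter fun (v : Fin (m + m) → Bool) => (∀ s ∈ S, ∀ x, ((C 1).eval x ^^ (C 1).eval (bxor x s) ^^ (C 1).eval (bxor x v) ^^ (C 1).eval (bxor x (bxor s v))) = false) ∧ (∀ u ∈ U, ((Finset.univ.filter fun i => u i && v i).card).bodd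 = false) ∧ ∀ j, (∀ y z : Fin (m + m) → Bool, (((C 1).eval z ^^ (C 1).eval (bxor z (xs j)) ^^ (C 1).eval (bxor z v) ^^ (C 1).eval (bxor z (bxor (xs j) v))) ^^ ((C 1).eval (bxor z y) ^^ (C 1).eval (bxor (bxor z y) (xs j)) ^^ (C 1).eval (bxor (bxor z y) v) ^^ (C 1).eval (bxor (bxor z y) (bxor (xs j) v)))) = false))).card : ℝ) / (((Finset.univ.filter fun (v : Fin (m + m) → Bool) => (∀ s ∈ S, ∀ x, ((C 1).eval x ^^ (C 1).eval (bxor x s) ^^ (C 1).eval (bxor x v) ^^ (C 1).eval (bxor x (bxor s v))) = false) ∧ (∀ u ∈ U, ((Finset.univ.filter fun i => u i && v i).card).bodd = false) ∧ ∀ j, (∀ y z : Fin (m + m) → Bool, (((C 1).eval z ^^ (C 1).eval (bxor z (xs j)) ^^ (C 1).eval (bxor z v) ^^ (C 1).eval (bxor z (bxor (xs j) v))) ^^ ((C 1).eval (bxor z y) ^^ (C 1).eval (bxor (bxor z y) (xs j)) ^^ (C 1).eval (bxor (bxor z y) v) ^^ (C 1).eval (bxor (bxor z y) (bxor (xs j)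 v)))) = false))).card : ℝ)))) := by
  intro h1 h2 h3 m C _hB hdeg hΦ horb S U hS hU hcb hca ho hSlt _hUlt hrad
  obtain ⟨v₀, hv₀R, hv₀Z, hv₀U, hv₀S⟩ := hrad
  -- the no-trap extension `V ⊋ S` of the pair
  obtain ⟨V, hV, hSV, hVU⟩ :=
    stub_noTrapTransport stub_noTrapTemplate m (C 0).eval (C 1).eval (hdeg 0) (hdeg 1) hΦ horb S U hS hU hcb hca ho
  have hcard : (V.card : ℝ) ^ 2 = (2 : ℝ) ^ (m + m) := hV.2.1
  have hVc : V.card = 2 ^ m := by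
    have h2 : (2 : ℝ) ^ (m + m) = ((2 : ℝ) ^ m) ^ 2 := by rw [← pow_mul]; ring_nf
    rw [h2] at hcard
    have hn : (0 : ℝ) ≤ V.card := by positivity
    have hp : (0 : ℝ) ≤ (2 : ℝ) ^ m := by positivity
    have := (pow_left_inj₀ hn hp two_ne_zero).1 hcard
    exact_mod_cast this
  have hSVlt : S.card < V.card := by rw [hVc]; exact hSlt
  refine ⟨m + m + 1, le_rfl, ?_⟩
  -- counting the tuples of probes
  have hcardα : Fintype.card (Fin (m + m + 1) → (Fin (m + m) → Bool)) = 2 ^ ((m + m) * (m + m + 1)) := by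
    rw [Fintype.card_fun, Fintype.card_fun, Fintype.card_bool, Fintype.card_fin, Fintype.card_fin, ← pow_mul]
  have hP : 2 * (Finset.univ.filter fun xs : Fin (m + m + 1) → (Fin (m + m) → Bool) =>
      ∃ w : Fin (m + m) → Bool, w ≠ zeroVec ∧
        ∀ j, ((Finset.univ.filter fun i => w i && xs j i).card).bodd = false).card ≤
      Fintype.card (Fin (m + m + 1) → (Fin (m + m) → Bool)) := by
    rw [hcardα]; exact h1 (m + m)
  refine le_trans ?_ (quarter_card_le_sum ?_ ?_ hP)
  · -- `2^{n(n+1)} / (n+2)^8 ≤ 2^{n(n+1)} / 4`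
    rw [hcardα]
    push_cast
    refine div_le_div_of_nonneg_left (by positivity) (by norm_num) ?_
    have hm : (2 : ℝ) ≤ (m : ℝ) + m + 2 := by linarith [(Nat.cast_nonneg m : (0 : ℝ) ≤ m)]
    calc (4 : ℝ) ≤ 2 ^ 8 := by norm_num
      _ ≤ ((m : ℝ) + m + 2) ^ 8 := pow_le_pow_left₀ (by norm_num) hm 8
  · -- every summand is `≥ 0`
    intro xs
    exact div_nonneg (Nat.cast_nonneg _) (Nat.cast_nonneg _)
  · -- spanning tuples: density `≥ 1/2`
    intro xs hxs
    have hdual : ∀ w : Fin (m + m) → Bool,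
        (∀ j, ((Finset.univ.filter fun i => w i && xs j i).card).bodd = false) → w = zeroVec := by
      intro w hw
      by_contra hne
      exact hxs ⟨w, hne, hw⟩
    have hspan := h2 (m + m) (m + m + 1) xs hdual
    refine half_le_card_filter_div_card _ _ _ S v₀ ?_ hv₀S hS.2 ?_ ?_
    · -- the radical witness is a candidate
      exact Finset.mem_filter.2 ⟨Finset.mem_univ _, hv₀Z, hv₀U, fun j => hv₀R (xs j)⟩
    · -- the candidate space is stable under `· ⊕ v₀`
      intro u hu
      have hu' := (Finset.mem_filter.1 hu).2
      exact Finset.mem_filter.2 ⟨Finset.mem_univ _, zs_bxor (C 1).eval S u v₀ hu'.1 hv₀Z,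
        pu_bxor U u v₀ hu'.2.1 hv₀U, fun j => rc_bxor_right (C 1).eval (xs j) u v₀ (hu'.2.2 j) (hv₀R (xs j))⟩
    · -- every candidate outside `S` is good
      intro u hu huS
      have hu' := (Finset.mem_filter.1 hu).2
      have hradu := radical_of_probes (C 1).eval xs u hspan hu'.2.2
      obtain ⟨V', hV', hSV', huV', hV'U⟩ := h3 (m + m) (C 1).eval S U V u hS hV hSV hVU hSVlt hradu hu'.1 hu'.2.1
      exact ⟨huS, V', hV', hSV', huV', hV'U⟩

end Summit.QuantumAdvantage.QuantumAdvantage.Theorems.SignedExactCubicForrelationNotPrBPP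

end
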